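import Literature.MathematicalPhysics.QuantumFieldTheory.Balaban1983to89.B13OpsYPencilRProj
import Literature.MathematicalPhysics.QuantumFieldTheory.Balaban1983to89.Node00.OpsYDeltaALocalProj
import Literature.MathematicalPhysics.QuantumFieldTheory.Balaban1983to89.B13OpsYPencilGreenPrimeSym

/-!
# `Balaban1983to89.B13DirichletLocalRProjLetters` — T. Bałaban, *Propagators for lattice gauge theories in a background field*, Commun. Math. Phys. **99**
# (1985) 389–434 [Balaban1985BackgroundPropagators], (3.25) p. 394 (`R = I − G′Q′*(Q′G′²Q′*)⁻¹Q′G′`), Sect. C pp. 408–409 (the Dirichlet letters `G′_□(U)`,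
# `C_□(U) = (Q′G′_□²Q′*)⁻¹`), (3.105) p. 414 (`D P_□ D*`), Thm 3.4 p. 400, Sect. B (3.66)–(3.72) pp. 403–405, Thm 3.10 (3.107)–(3.108) p. 416; *Renormalization group
# approach to lattice gauge field theories. II*, Commun. Math. Phys. **116** (1988) 1–22 [Balaban1988RG2Cluster] (2.5)–(2.7) pp. 12–13; *Propagators and
# renormalization transformations … II*, Commun. Math. Phys. **96** (1984) 223–250 [Balaban1984PropagatorsII] (2.54) p. 232, Lemma 2.1 (2.61) p. 234:
# STATION L3 OF THE N10 LANE's LOCAL-CUBE ROAD — the N10 entry letters of def-Y's LOCAL GAUGE PROJECTION `R_□ = I − G′_□Q′*C_□Q′G′_□` (and of `P_□`) ALONG ANY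
# HOLOMORPHIC BACKGROUND FAMILY, from the letters of `G′_□` (station L1) and of `C_□` (station L2), DISPLAYED.

THE ROAD (N10 lane census v21.1 item 5; dag-n10-w3 g5's design, HOME INBOX l.37915 ∕ l.38011).  The inverse road of [B9] Sect. B localised to def-Y's Dirichlet cube
letters `GsqY → ClocY → RlocY → deltaALocY ∕ padDeltaALocY` (`Node00/OpsYDeltaALocal`), every station GENERIC IN THE CHART AND THE BACKGROUND FAMILY (any
`F : E → CfgY 𝔸 i` on a ball of a complex normed space `E`; pv27's pencil `A′ ↦ e^{iηA′}U₀` is the instance `F := prodCfg U₀ η`), ending in row 17's LOCAL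
clause.  THIS FILE = station L3: products and sandwiches only — w2 g2's transporter-generic R-station (`B13OpsYPencilRProj` §1 ∕ §3) RE-ISSUED with
`(G′, X⁻¹, e^{iηA′}U₀) ↦ (G′_□, C_□, F(u))`.

WHAT THIS FILE PROVES (kernel-checked; theorems only, 0 `def`; nothing of NODE 00's, w2's or the lane's files is modified).
* §1 w2 g2's six transporter-matrix facts FAMILY-GENERIC (`…_of_family`: holomorphy, entry bounds, row ∕ column sums of the rectangular matrices of `Q′(F u)`,
  `Q′*(F u)` in the product bases, from the displayed transporter facts along `F` — proofs = w2's, over 68 `differentiableOn_coord_trLift` ∕ 73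
  `norm_coord_trLift_le_of_support`, which are already generic in the chart space `E`).
* §2 `toMatrix_PlocY_eq` · `toMatrix_RlocY_eq` — def-Y's `P_□ = G′_□ ∘ Q′* ∘ C_□ ∘ Q′ ∘ G′_□`, `R_□ = id − P_□` in the site-sector product basis (dictionary).
* §3 ★★★ `rawEntryLetters_toMatrix_PlocY_of_family` and ★★★ `rawEntryLetters_toMatrix_RlocY_of_family` — THE STATION: letters of `u ↦ toMatrix (P_□(F u))` and of
  `u ↦ toMatrix (R_□(F u))` from L1's `G′_□` letters + L2's `C_□` letters + the transporter facts; constants `B_G·(B_N·B_G·M)·M` resp. `1 + …`,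
  `M = m_S·c₀(1,μ)^ν`, `B_N = CQsr·|κ|·(cb·KQ·cl·KQ) · CQc·|κ|·(cb·KQ·cl·KQ) · B_C · e^{2ρr}`, rate `ρ − 2μ`, radius unchanged.
* §4 the PENCIL INSTANCES `F := prodCfg U₀ η` at def-Y's v2 transporter `parSY` (73's transporter facts BY NAME, as w2 §4) — `…_parSY_prodCfg`.

HONEST FRAMING: letter-algebra bookkeeping (34 `rawEntryLetters_mul_torus ∕ _sub ∕ _one`, 56A-family `rawEntryLetters_sandwich_family`) composed BY NAME with w2 g2's
road and def-Y's `rfl`-level definitions; L1's and L2's outputs (`G′_□` and `C_□` letters) are DISPLAYED HYPOTHESES — neither Theorem 3.2's content for `C_□` nor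
any decay of `G′_□` is asserted; no invertibility hypothesis is needed (def-Y's `ClocY` is total); nothing of (3.35); the scaled (3.37) pencil is a later
INSTANCE (w3 g5's LOCATED (c)); N06 ∕ N10 NOT discharged; K1⁹ NOT closed; counts unmoved (typed 28∕28 · discharged 5∕27); 0 `sorry`, standard axioms; no
`instance`, no notation; one finite 𝕋⁴ programme at fixed ε — R4 closes the conditional finite-𝕋⁴ rung `BalabanLadder.UV` only; the YM mass gap (Clay) is NOT
proved by any of this; nothing continuum ∕ ℝ⁴ ∕ OS.

WHY THIS FILE (cell `pub-ymgap`, HUMAN RULING D-0062 ∕ D-0149, Track A node N10 = [B13] → N06 row 17; width seat `pub-ymgap-dag-n10-w6` g4, OFFER-2 ∕ CLAIM-2 on the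
local-cube road, HOME INBOX 2026-08-28T13:03Z; key K1⁹ stmt-QuantumFields-27364, count-neutral helper).
-/

noncomputable section

namespace Literature.MathematicalPhysics.QuantumFieldTheory.Balaban1983to89.B13DirichletLocalRProjLetters

open Metric Set Finset Module
open scoped Matrix
open Literature.MathematicalPhysics.QuantumFieldTheory.Balaban1983to89
open Literature.MathematicalPhysics.QuantumFieldTheory.Balaban1983to89.B9Thm37GlueTorus (tdist1)
open Literature.MathematicalPhysics.QuantumFieldTheory.Balaban1983to89.B5TorusCover (UT)
open Literature.MathematicalPhysics.QuantumFieldTheory.Balaban1983to89.B13EntrywiseWalks (RawEntryLetters)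
open Literature.MathematicalPhysics.QuantumFieldTheory.Balaban1983to89.B13EntryLetterAlgebra
  (rawEntryLetters_mono rawEntryLetters_congr rawEntryLetters_mul_torus rawEntryLetters_one rawEntryLetters_sub)
open Literature.MathematicalPhysics.QuantumFieldTheory.Balaban1983to89.B13EntryLetterAlgebraFamily (rawEntryLetters_sandwich_family)
open Literature.MathematicalPhysics.QuantumFieldTheory.Balaban1983to89.B13OpsYPencilXQuad
  (toMatrix_piProd_rect_apply toMatrix_QpY_eq toMatrix_QpsY_eq tdist_le_of_toMatrix_QpY_ne_zero tdist_le_of_toMatrix_QpsY_ne_zero)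
open Literature.MathematicalPhysics.QuantumFieldTheory.Balaban1983to89.B13TransportedLiftLetters (differentiableOn_coord_trLift)
open Literature.MathematicalPhysics.QuantumFieldTheory.Balaban1983to89.B13OpsYPencilAveraging
  (norm_coord_trLift_le_of_support differentiableOn_qpT_prodCfg differentiableOn_qpT_inv_prodCfg norm_qpT_prodCfg_le norm_qpT_inv_prodCfg_le)
open Literature.MathematicalPhysics.QuantumFieldTheory.Balaban1983to89.B13OpsYPencilGreenPrimeSym
  (differentiableOn_parSymY_prodCfg differentiableOn_parSymY_inv_prodCfg norm_parSymY_prodCfg_le norm_parSymY_inv_prodCfg_le)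
open Literature.MathematicalPhysics.QuantumFieldTheory.Balaban1983to89.B9Eq39Adjoint (R R_def prodCfg)
open Literature.MathematicalPhysics.QuantumFieldTheory.Balaban1983to89.B6GlobalChartV1 (PV boxEquiv)
open Literature.MathematicalPhysics.QuantumFieldTheory.Balaban1983to89.B6KLevelCensusIndexV1 (KIdx)
open Literature.MathematicalPhysics.QuantumFieldTheory.Balaban1983to89.Node00
open Literature.MathematicalPhysics.QuantumFieldTheory.Balaban1983to89.Node00.OpsYLocalInverse (GsqY)
open Literature.MathematicalPhysics.QuantumFieldTheory.Balaban1983to89.Node00.OpsYDeltaALocal (ClocY PlocY RlocY)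

variable {𝔸 : Type} [NormedRing 𝔸] [NormedAlgebra ℂ 𝔸] [CompleteSpace 𝔸]
variable {d ℓ : ℕ} {hd : 1 ≤ d + 1} {hL : Odd (ℓ + 1) ∧ 1 < ℓ + 1} {b₀ b₁ : ℝ}
variable (i : KIdx d ℓ hd hL b₀ b₁)
variable {κ : Type} [Fintype κ] [DecidableEq κ] (b : Basis κ ℂ 𝔸)
variable (parS : SiteParY 𝔸 i) {E : Type*} [NormedAddCommGroup E] [NormedSpace ℂ E] (F : E → CfgY 𝔸 i) {Rc KQ : ℝ}
variable [DecidableEq (SiteY i)] [DecidableEq (BlkY i)]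

/-! ## §1. Transporter-generic `Q′ ∕ Q′*` rectangular families along ANY holomorphic background family -/

section Generic

omit [DecidableEq (BlkY i)] in
/-- `Q′` along ANY holomorphic background family `F : E → CfgY`, ANY `parS`: every rectangular matrix entry is HOLOMORPHIC once `u ↦ qpT i parS (F u) s z` and its
inverse are (68 `differentiableOn_coord_trLift` at `φ_k := (b.coord k).mkContinuous cb`; w2 g2's `…_prodCfg_of` is the pencil case `F := prodCfg U₀ η`). [cite: Balaban1985BackgroundPropagators, (3.19), (3.21) pp.393–394, Thm 3.4 p.400] -/
theorem differentiableOn_toMatrix_QpY_of_family {cb : ℝ} (hcb : ∀ (x : 𝔸) (k : κ), ‖b.repr x k‖ ≤ cb * ‖x‖)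
    (hQh : ∀ s z, DifferentiableOn ℂ (fun u : E => (qpT i parS (F u) s z : 𝔸)) (ball (0 : E) Rc))
    (hQhi : ∀ s z, DifferentiableOn ℂ (fun u : E =>
      (((qpT i parS (F u) s z)⁻¹ : 𝔸ˣ) : 𝔸)) (ball (0 : E) Rc))
    (p : BlkY i × κ) (q : SiteY i × κ) :
    DifferentiableOn ℂ (fun u : E =>
      LinearMap.toMatrix ((Pi.basis fun _ : SiteY i => b).reindex (Equiv.sigmaEquivProd (SiteY i) κ))
        ((Pi.basis fun _ : BlkY i => b).reindex (Equiv.sigmaEquivProd (BlkY i) κ)) (QpY i parS (F u)) p q) (ball (0 : E) Rc) := by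
  obtain ⟨s, k⟩ := p
  obtain ⟨z, l⟩ := q
  have h := differentiableOn_coord_trLift (qpK i) (fun u => qpT i parS (F u))
    (fun k => (b.coord k).mkContinuous cb (fun x => by rw [Basis.coord_apply]; exact hcb x k)) b hQh hQhi s z k l
  refine h.congr fun a _ => ?_
  rw [toMatrix_QpY_eq, LinearMap.mkContinuous_apply, Basis.coord_apply]

omit [DecidableEq (SiteY i)] in
/-- `Q′*` along ANY background family `F`, ANY `parS`: every rectangular matrix entry is HOLOMORPHIC (the inverted transporters).
[cite: Balaban1985BackgroundPropagators, (3.24) p.394, Thm 3.4 p.400] -/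
theorem differentiableOn_toMatrix_QpsY_of_family {cb : ℝ} (hcb : ∀ (x : 𝔸) (k : κ), ‖b.repr x k‖ ≤ cb * ‖x‖)
    (hQh : ∀ s z, DifferentiableOn ℂ (fun u : E => (qpT i parS (F u) s z : 𝔸)) (ball (0 : E) Rc))
    (hQhi : ∀ s z, DifferentiableOn ℂ (fun u : E =>
      (((qpT i parS (F u) s z)⁻¹ : 𝔸ˣ) : 𝔸)) (ball (0 : E) Rc))
    (q : SiteY i × κ) (p : BlkY i × κ) :
    DifferentiableOn ℂ (fun u : E =>
      LinearMap.toMatrix ((Pi.basis fun _ : BlkY i => b).reindex (Equiv.sigmaEquivProd (BlkY i) κ))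
        ((Pi.basis fun _ : SiteY i => b).reindex (Equiv.sigmaEquivProd (SiteY i) κ)) (QpsY i parS (F u)) q p) (ball (0 : E) Rc) := by
  obtain ⟨z, k⟩ := q
  obtain ⟨s, l⟩ := p
  have h := differentiableOn_coord_trLift (qpsK i) (fun u z s => (qpT i parS (F u) s z)⁻¹)
    (fun k => (b.coord k).mkContinuous cb (fun x => by rw [Basis.coord_apply]; exact hcb x k)) b
    (fun z s => hQhi s z) (fun z s => by simpa only [inv_inv] using hQh s z) z s k l
  refine h.congr fun a _ => ?_
  rw [toMatrix_QpsY_eq, LinearMap.mkContinuous_apply, Basis.coord_apply]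

variable {ν : ℕ} {Nf : Fin ν → ℕ} [∀ j, NeZero (Nf j)]

omit [NormedSpace ℂ E] [DecidableEq (BlkY i)] in
/-- `Q′` along ANY family `F`, ANY `parS`: ENTRY BOUND `≤ |qpK(s,z)|·(cb·(KQ·cl·KQ))` from ONE transporter numeral `KQ ≥ 0` on `qpK`'s support (73 `norm_coord_trLift_le_of_support`).
[cite: Balaban1985BackgroundPropagators, (3.19) p.393, (3.40) p.397, (3.108) p.416] -/
theorem norm_toMatrix_QpY_le_of_family {cb cl : ℝ} (hcb : ∀ (x : 𝔸) (k : κ), ‖b.repr x k‖ ≤ cb * ‖x‖) (hcb0 : 0 ≤ cb) (hcl : ∀ l, ‖b l‖ ≤ cl)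
    (hKQ : 0 ≤ KQ)
    (hQf : ∀ u ∈ ball (0 : E) Rc, ∀ s z, qpK i s z ≠ 0 → ‖(qpT i parS (F u) s z : 𝔸)‖ ≤ KQ)
    (hQb : ∀ u ∈ ball (0 : E) Rc, ∀ s z, qpK i s z ≠ 0 →
      ‖(((qpT i parS (F u) s z)⁻¹ : 𝔸ˣ) : 𝔸)‖ ≤ KQ)
    {u : E} (hu : u ∈ ball (0 : E) Rc) (p : BlkY i × κ) (q : SiteY i × κ) :
    ‖LinearMap.toMatrix ((Pi.basis fun _ : SiteY i => b).reindex (Equiv.sigmaEquivProd (SiteY i) κ))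
      ((Pi.basis fun _ : BlkY i => b).reindex (Equiv.sigmaEquivProd (BlkY i) κ)) (QpY i parS (F u)) p q‖ ≤
      |qpK i p.1 q.1| * (cb * (KQ * cl * KQ)) := by
  obtain ⟨s, k⟩ := p
  obtain ⟨z, l⟩ := q
  set φ : κ → 𝔸 →L[ℂ] ℂ := fun k => (b.coord k).mkContinuous cb (fun x => by rw [Basis.coord_apply]; exact hcb x k) with hφ
  have e1 : LinearMap.toMatrix ((Pi.basis fun _ : SiteY i => b).reindex (Equiv.sigmaEquivProd (SiteY i) κ))
      ((Pi.basis fun _ : BlkY i => b).reindex (Equiv.sigmaEquivProd (BlkY i) κ)) (QpY i parS (F u)) (s, k) (z, l) =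
      ((qpK i s z : ℝ) : ℂ) * φ k (R (qpT i parS (F u) s z) (b l)) := by
    rw [toMatrix_QpY_eq, hφ, LinearMap.mkContinuous_apply, Basis.coord_apply]
  rw [e1]
  refine (norm_coord_trLift_le_of_support (qpK i) (fun u => qpT i parS (F u)) φ b hKQ hQf hQb hu s z k l).trans ?_
  refine mul_le_mul_of_nonneg_left ?_ (abs_nonneg _)
  refine mul_le_mul (LinearMap.mkContinuous_norm_le _ hcb0 _) ?_ (by positivity) hcb0
  exact mul_le_mul_of_nonneg_right (mul_le_mul_of_nonneg_left (hcl l) hKQ) hKQ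

omit [NormedSpace ℂ E] [DecidableEq (SiteY i)] in
/-- `Q′*` along ANY family `F`, ANY `parS`: ENTRY BOUND `≤ |qpsK(z,s)|·(cb·(KQ·cl·KQ))` from the transporter numeral `KQ` on `qpsK`'s support.
[cite: Balaban1985BackgroundPropagators, (3.24) p.394, (3.40) p.397, (3.108) p.416] -/
theorem norm_toMatrix_QpsY_le_of_family {cb cl : ℝ} (hcb : ∀ (x : 𝔸) (k : κ), ‖b.repr x k‖ ≤ cb * ‖x‖) (hcb0 : 0 ≤ cb) (hcl : ∀ l, ‖b l‖ ≤ cl)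
    (hKQ : 0 ≤ KQ)
    (hQsf : ∀ u ∈ ball (0 : E) Rc, ∀ z s, qpsK i z s ≠ 0 →
      ‖(((qpT i parS (F u) s z)⁻¹ : 𝔸ˣ) : 𝔸)‖ ≤ KQ)
    (hQsb : ∀ u ∈ ball (0 : E) Rc, ∀ z s, qpsK i z s ≠ 0 → ‖(qpT i parS (F u) s z : 𝔸)‖ ≤ KQ)
    {u : E} (hu : u ∈ ball (0 : E) Rc) (q : SiteY i × κ) (p : BlkY i × κ) :
    ‖LinearMap.toMatrix ((Pi.basis fun _ : BlkY i => b).reindex (Equiv.sigmaEquivProd (BlkY i) κ))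
      ((Pi.basis fun _ : SiteY i => b).reindex (Equiv.sigmaEquivProd (SiteY i) κ)) (QpsY i parS (F u)) q p‖ ≤
      |qpsK i q.1 p.1| * (cb * (KQ * cl * KQ)) := by
  obtain ⟨z, k⟩ := q
  obtain ⟨s, l⟩ := p
  set φ : κ → 𝔸 →L[ℂ] ℂ := fun k => (b.coord k).mkContinuous cb (fun x => by rw [Basis.coord_apply]; exact hcb x k) with hφ
  have e1 : LinearMap.toMatrix ((Pi.basis fun _ : BlkY i => b).reindex (Equiv.sigmaEquivProd (BlkY i) κ))
      ((Pi.basis fun _ : SiteY i => b).reindex (Equiv.sigmaEquivProd (SiteY i) κ)) (QpsY i parS (F u)) (z, k) (s, l) =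
      ((qpsK i z s : ℝ) : ℂ) * φ k (R (qpT i parS (F u) s z)⁻¹ (b l)) := by
    rw [toMatrix_QpsY_eq, hφ, LinearMap.mkContinuous_apply, Basis.coord_apply]
  rw [e1]
  have h := norm_coord_trLift_le_of_support (qpsK i) (fun u z s => (qpT i parS (F u) s z)⁻¹) φ b hKQ hQsf
    (fun u hu z s hM => by simpa only [inv_inv] using hQsb u hu z s hM) hu z s k l
  refine h.trans ?_
  refine mul_le_mul_of_nonneg_left ?_ (abs_nonneg _)
  refine mul_le_mul (LinearMap.mkContinuous_norm_le _ hcb0 _) ?_ (by positivity) hcb0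
  exact mul_le_mul_of_nonneg_right (mul_le_mul_of_nonneg_left (hcl l) hKQ) hKQ

omit [NormedSpace ℂ E] [DecidableEq (SiteY i)] in
/-- `Q′*` along ANY family `F`, ANY `parS`: ROW SUMS over the block index `Σ_{(s,l)} ‖toMatrix(Q′*)(z,k)(s,l)‖ ≤ CQsr·|κ|·(cb·(KQ·cl·KQ))`, numeral `CQsr ≥ Σ_s |qpsK(z,s)|`.
[cite: Balaban1985BackgroundPropagators, (3.24) p.394; Balaban1984PropagatorsII, (2.54) p.232] -/
theorem rowSum_blk_toMatrix_QpsY_le_of_family {cb cl : ℝ} (hcb : ∀ (x : 𝔸) (k : κ), ‖b.repr x k‖ ≤ cb * ‖x‖) (hcb0 : 0 ≤ cb) (hcl : ∀ l, ‖b l‖ ≤ cl)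
    (hcl0 : 0 ≤ cl) (hKQ : 0 ≤ KQ)
    (hQsf : ∀ u ∈ ball (0 : E) Rc, ∀ z s, qpsK i z s ≠ 0 →
      ‖(((qpT i parS (F u) s z)⁻¹ : 𝔸ˣ) : 𝔸)‖ ≤ KQ)
    (hQsb : ∀ u ∈ ball (0 : E) Rc, ∀ z s, qpsK i z s ≠ 0 → ‖(qpT i parS (F u) s z : 𝔸)‖ ≤ KQ)
    {CQsr : ℝ} (hCQsr : ∀ z, ∑ s, |qpsK i z s| ≤ CQsr)
    {u : E} (hu : u ∈ ball (0 : E) Rc) (q : SiteY i × κ) :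
    ∑ p : BlkY i × κ, ‖LinearMap.toMatrix ((Pi.basis fun _ : BlkY i => b).reindex (Equiv.sigmaEquivProd (BlkY i) κ))
      ((Pi.basis fun _ : SiteY i => b).reindex (Equiv.sigmaEquivProd (SiteY i) κ)) (QpsY i parS (F u)) q p‖ ≤
      CQsr * (Fintype.card κ : ℝ) * (cb * (KQ * cl * KQ)) := by
  set c : ℝ := cb * (KQ * cl * KQ) with hc
  have hc0 : 0 ≤ c := mul_nonneg hcb0 (mul_nonneg (mul_nonneg hKQ hcl0) hKQ)
  calc ∑ p : BlkY i × κ, ‖LinearMap.toMatrix ((Pi.basis fun _ : BlkY i => b).reindex (Equiv.sigmaEquivProd (BlkY i) κ))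
          ((Pi.basis fun _ : SiteY i => b).reindex (Equiv.sigmaEquivProd (SiteY i) κ)) (QpsY i parS (F u)) q p‖
      ≤ ∑ p : BlkY i × κ, |qpsK i q.1 p.1| * c :=
        Finset.sum_le_sum fun p _ => norm_toMatrix_QpsY_le_of_family i b parS F hcb hcb0 hcl hKQ hQsf hQsb hu q p
    _ = (∑ s : BlkY i, |qpsK i q.1 s|) * (Fintype.card κ : ℝ) * c := by
        rw [Fintype.sum_prod_type, Finset.sum_mul, Finset.sum_mul]
        refine Finset.sum_congr rfl fun s _ => ?_
        show ∑ _y : κ, |qpsK i q.1 s| * c = _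
        rw [Finset.sum_const, Finset.card_univ, nsmul_eq_mul]
        ring
    _ ≤ CQsr * (Fintype.card κ : ℝ) * c :=
        mul_le_mul_of_nonneg_right (mul_le_mul_of_nonneg_right (hCQsr q.1) (Nat.cast_nonneg _)) hc0

omit [NormedSpace ℂ E] [DecidableEq (BlkY i)] in
/-- `Q′` along ANY family `F`, ANY `parS`: COLUMN SUMS over the block index `Σ_{(s,k)} ‖toMatrix(Q′)(s,k)(z,l)‖ ≤ CQc·|κ|·(cb·(KQ·cl·KQ))`, numeral `CQc ≥ Σ_s |qpK(s,z)|`.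
[cite: Balaban1985BackgroundPropagators, (3.19) p.393; Balaban1984PropagatorsII, (2.54) p.232] -/
theorem colSum_blk_toMatrix_QpY_le_of_family {cb cl : ℝ} (hcb : ∀ (x : 𝔸) (k : κ), ‖b.repr x k‖ ≤ cb * ‖x‖) (hcb0 : 0 ≤ cb) (hcl : ∀ l, ‖b l‖ ≤ cl)
    (hcl0 : 0 ≤ cl) (hKQ : 0 ≤ KQ)
    (hQf : ∀ u ∈ ball (0 : E) Rc, ∀ s z, qpK i s z ≠ 0 → ‖(qpT i parS (F u) s z : 𝔸)‖ ≤ KQ)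
    (hQb : ∀ u ∈ ball (0 : E) Rc, ∀ s z, qpK i s z ≠ 0 →
      ‖(((qpT i parS (F u) s z)⁻¹ : 𝔸ˣ) : 𝔸)‖ ≤ KQ)
    {CQc : ℝ} (hCQc : ∀ z, ∑ s, |qpK i s z| ≤ CQc)
    {u : E} (hu : u ∈ ball (0 : E) Rc) (q : SiteY i × κ) :
    ∑ p : BlkY i × κ, ‖LinearMap.toMatrix ((Pi.basis fun _ : SiteY i => b).reindex (Equiv.sigmaEquivProd (SiteY i) κ))
      ((Pi.basis fun _ : BlkY i => b).reindex (Equiv.sigmaEquivProd (BlkY i) κ)) (QpY i parS (F u)) p q‖ ≤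
      CQc * (Fintype.card κ : ℝ) * (cb * (KQ * cl * KQ)) := by
  set c : ℝ := cb * (KQ * cl * KQ) with hc
  have hc0 : 0 ≤ c := mul_nonneg hcb0 (mul_nonneg (mul_nonneg hKQ hcl0) hKQ)
  calc ∑ p : BlkY i × κ, ‖LinearMap.toMatrix ((Pi.basis fun _ : SiteY i => b).reindex (Equiv.sigmaEquivProd (SiteY i) κ))
          ((Pi.basis fun _ : BlkY i => b).reindex (Equiv.sigmaEquivProd (BlkY i) κ)) (QpY i parS (F u)) p q‖
      ≤ ∑ p : BlkY i × κ, |qpK i p.1 q.1| * c :=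
        Finset.sum_le_sum fun p _ => norm_toMatrix_QpY_le_of_family i b parS F hcb hcb0 hcl hKQ hQf hQb hu p q
    _ = (∑ s : BlkY i, |qpK i s q.1|) * (Fintype.card κ : ℝ) * c := by
        rw [Fintype.sum_prod_type, Finset.sum_mul, Finset.sum_mul]
        refine Finset.sum_congr rfl fun s _ => ?_
        show ∑ _y : κ, |qpK i s q.1| * c = _
        rw [Finset.sum_const, Finset.card_univ, nsmul_eq_mul]
        ring
    _ ≤ CQc * (Fintype.card κ : ℝ) * c :=
        mul_le_mul_of_nonneg_right (mul_le_mul_of_nonneg_right (hCQc q.1) (Nat.cast_nonneg _)) hc0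


end Generic

/-! ## §2. The matrices of `P_□(U)` and `R_□(U)` -/

section Identification

variable (D : Finset (SiteY i)) (P : Module.End ℂ (BlkY i → 𝔸))

/-- The matrix of def-Y's `P_□(U) = G′_□Q′*C_□Q′G′_□` in the site-sector product basis, any `parS`, cube `D`, cut `P`, `U` (`LinearMap.toMatrix_comp`).
[cite: Balaban1985BackgroundPropagators, (3.105) p.414, p.415 (P = G′Q′*(Q′G′²Q′*)⁻¹Q′G′), pp.408–409, dictionary] -/
theorem toMatrix_PlocY_eq (U : CfgY 𝔸 i) :
    LinearMap.toMatrix ((Pi.basis fun _ : SiteY i => b).reindex (Equiv.sigmaEquivProd (SiteY i) κ))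
      ((Pi.basis fun _ : SiteY i => b).reindex (Equiv.sigmaEquivProd (SiteY i) κ)) (PlocY i parS D P U) =
    LinearMap.toMatrix ((Pi.basis fun _ : SiteY i => b).reindex (Equiv.sigmaEquivProd (SiteY i) κ))
          ((Pi.basis fun _ : SiteY i => b).reindex (Equiv.sigmaEquivProd (SiteY i) κ)) (GsqY i parS D U) *
      ((LinearMap.toMatrix ((Pi.basis fun _ : BlkY i => b).reindex (Equiv.sigmaEquivProd (BlkY i) κ))
            ((Pi.basis fun _ : SiteY i => b).reindex (Equiv.sigmaEquivProd (SiteY i) κ)) (QpsY i parS U) *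
          LinearMap.toMatrix ((Pi.basis fun _ : BlkY i => b).reindex (Equiv.sigmaEquivProd (BlkY i) κ))
            ((Pi.basis fun _ : BlkY i => b).reindex (Equiv.sigmaEquivProd (BlkY i) κ)) (ClocY i parS D P U) *
          LinearMap.toMatrix ((Pi.basis fun _ : SiteY i => b).reindex (Equiv.sigmaEquivProd (SiteY i) κ))
            ((Pi.basis fun _ : BlkY i => b).reindex (Equiv.sigmaEquivProd (BlkY i) κ)) (QpY i parS U)) *
        LinearMap.toMatrix ((Pi.basis fun _ : SiteY i => b).reindex (Equiv.sigmaEquivProd (SiteY i) κ))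
          ((Pi.basis fun _ : SiteY i => b).reindex (Equiv.sigmaEquivProd (SiteY i) κ)) (GsqY i parS D U)) := by
  have hP : PlocY i parS D P U = GsqY i parS D U ∘ₗ (QpsY i parS U ∘ₗ (ClocY i parS D P U ∘ₗ (QpY i parS U ∘ₗ GsqY i parS D U))) := rfl
  rw [hP, LinearMap.toMatrix_comp _ ((Pi.basis fun _ : SiteY i => b).reindex (Equiv.sigmaEquivProd (SiteY i) κ)),
    LinearMap.toMatrix_comp _ ((Pi.basis fun _ : BlkY i => b).reindex (Equiv.sigmaEquivProd (BlkY i) κ)),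
    LinearMap.toMatrix_comp _ ((Pi.basis fun _ : BlkY i => b).reindex (Equiv.sigmaEquivProd (BlkY i) κ)),
    LinearMap.toMatrix_comp _ ((Pi.basis fun _ : SiteY i => b).reindex (Equiv.sigmaEquivProd (SiteY i) κ))]
  simp only [Matrix.mul_assoc]

/-- The matrix of def-Y's local gauge projection `R_□(U) = I − P_□(U)` in the site-sector product basis (`LinearMap.toMatrix_id`, linearity).
[cite: Balaban1985BackgroundPropagators, (3.25) p.394, (3.105) p.414, pp.408–409, dictionary] -/
theorem toMatrix_RlocY_eq (U : CfgY 𝔸 i) :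
    LinearMap.toMatrix ((Pi.basis fun _ : SiteY i => b).reindex (Equiv.sigmaEquivProd (SiteY i) κ))
      ((Pi.basis fun _ : SiteY i => b).reindex (Equiv.sigmaEquivProd (SiteY i) κ)) (RlocY i parS D P U) =
    1 - LinearMap.toMatrix ((Pi.basis fun _ : SiteY i => b).reindex (Equiv.sigmaEquivProd (SiteY i) κ))
          ((Pi.basis fun _ : SiteY i => b).reindex (Equiv.sigmaEquivProd (SiteY i) κ)) (GsqY i parS D U) *
      ((LinearMap.toMatrix ((Pi.basis fun _ : BlkY i => b).reindex (Equiv.sigmaEquivProd (BlkY i) κ))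
            ((Pi.basis fun _ : SiteY i => b).reindex (Equiv.sigmaEquivProd (SiteY i) κ)) (QpsY i parS U) *
          LinearMap.toMatrix ((Pi.basis fun _ : BlkY i => b).reindex (Equiv.sigmaEquivProd (BlkY i) κ))
            ((Pi.basis fun _ : BlkY i => b).reindex (Equiv.sigmaEquivProd (BlkY i) κ)) (ClocY i parS D P U) *
          LinearMap.toMatrix ((Pi.basis fun _ : SiteY i => b).reindex (Equiv.sigmaEquivProd (SiteY i) κ))
            ((Pi.basis fun _ : BlkY i => b).reindex (Equiv.sigmaEquivProd (BlkY i) κ)) (QpY i parS U)) *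
        LinearMap.toMatrix ((Pi.basis fun _ : SiteY i => b).reindex (Equiv.sigmaEquivProd (SiteY i) κ))
          ((Pi.basis fun _ : SiteY i => b).reindex (Equiv.sigmaEquivProd (SiteY i) κ)) (GsqY i parS D U)) := by
  have hR : RlocY i parS D P U = LinearMap.id - PlocY i parS D P U := rfl
  rw [hR, map_sub, LinearMap.toMatrix_id, toMatrix_PlocY_eq]

end Identification

/-! ## §3. ★★★ STATION L3: `P_□` and `R_□` along any holomorphic background family, transporter-generic -/

section RStation

variable (D : Finset (SiteY i)) (P : Module.End ℂ (BlkY i → 𝔸))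
variable {ν : ℕ} {Nf : Fin ν → ℕ} [∀ j, NeZero (Nf j)]

/-- ★★★ **STATION L3 — THE LOCAL GAUGE PROJECTION `R_□(F(u)) = I − G′_□Q′*C_□Q′G′_□` ALONG ANY HOLOMORPHIC BACKGROUND FAMILY `F : E → CfgY`, IN N10
COORDINATES, FOR ANY TRANSPORTER LETTER `parS`, ANY CUBE `D` AND ANY BLOCK CUT `P`** (def-Y's `RlocY i parS D P` = (3.25) with the Dirichlet letters
`G′_□ = GsqY i parS D`, `C_□ = ClocY i parS D P` of pp. 408–409; w2 g2's R-STATION `B13OpsYPencilRProj.rawEntryLetters_toMatrix_RY_prodCfg` with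
`(G′, X⁻¹, e^{iηA′}U₀) ↦ (G′_□, C_□, F(u))`, same road, same constants).  DISPLAYED INPUTS: station L1's output = `G′_□`'s letters `(Rc, ρ, B_G)` on the site
sector along `F`, station L2's output = `C_□`'s letters `(Rc, ρ, B_C)` on the block sector along `F` (both as hypotheses — nothing of L1 ∕ L2 is proved or
restated here); §1's transporter facts along `F` (`hQh hQhi` holomorphy, `hQf hQb hQsf hQsb` the numeral `KQ ≥ 0` on the supports); the kernel numerals
`CQsr, CQc ≥ 0` and a reading pair `ℓS, ℓB` with range `r` (`qpK(s,z) ≠ 0 ⇒ d₁(ℓB s, ℓS z) ≤ r`, `qpsK(z,s) ≠ 0 ⇒ d₁(ℓS z, ℓB s) ≤ r`); the basis numerals; a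
fibre bound `m_S` of `ℓS`; `0 < μ`, `2μ ≤ ρ`.  Conclusion: `RawEntryLetters (u ↦ toMatrix (R_□(F u))) (ℓS ∘ fst) Rc (ρ − 2μ) (1 + B_G·(B_N·B_G·M)·M)`,
`M = m_S·c₀(1,μ)^ν`, `B_N = a·b·B_C·e^{2ρr}` — w2's constants verbatim with `B_X ↦ B_C`.
[cite: Balaban1985BackgroundPropagators, (3.25) p.394, Thm 3.4 p.400, (3.66)–(3.68) p.403, (3.69)–(3.70) p.404, (3.105) p.414, pp.408–409 (G′_□, C_□), Thm 3.10 (3.108) p.416;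
Balaban1988RG2Cluster, (2.5)–(2.7) pp.12–13; Balaban1984PropagatorsII, (2.54) p.232, Lemma 2.1 (2.61) p.234] -/
theorem rawEntryLetters_toMatrix_RlocY_of_family {cb cl : ℝ}
    (hcb : ∀ (x : 𝔸) (k : κ), ‖b.repr x k‖ ≤ cb * ‖x‖) (hcb0 : 0 ≤ cb) (hcl : ∀ l, ‖b l‖ ≤ cl) (hcl0 : 0 ≤ cl) (hKQ : 0 ≤ KQ)
    (hQh : ∀ s z, DifferentiableOn ℂ (fun u : E => (qpT i parS (F u) s z : 𝔸)) (ball (0 : E) Rc))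
    (hQhi : ∀ s z, DifferentiableOn ℂ (fun u : E =>
      (((qpT i parS (F u) s z)⁻¹ : 𝔸ˣ) : 𝔸)) (ball (0 : E) Rc))
    (hQf : ∀ u ∈ ball (0 : E) Rc, ∀ s z, qpK i s z ≠ 0 → ‖(qpT i parS (F u) s z : 𝔸)‖ ≤ KQ)
    (hQb : ∀ u ∈ ball (0 : E) Rc, ∀ s z, qpK i s z ≠ 0 →
      ‖(((qpT i parS (F u) s z)⁻¹ : 𝔸ˣ) : 𝔸)‖ ≤ KQ)
    (hQsf : ∀ u ∈ ball (0 : E) Rc, ∀ z s, qpsK i z s ≠ 0 →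
      ‖(((qpT i parS (F u) s z)⁻¹ : 𝔸ˣ) : 𝔸)‖ ≤ KQ)
    (hQsb : ∀ u ∈ ball (0 : E) Rc, ∀ z s, qpsK i z s ≠ 0 → ‖(qpT i parS (F u) s z : 𝔸)‖ ≤ KQ)
    {CQsr CQc : ℝ} (hCQsr0 : 0 ≤ CQsr) (hCQsr : ∀ z, ∑ s, |qpsK i z s| ≤ CQsr) (hCQc0 : 0 ≤ CQc) (hCQc : ∀ z, ∑ s, |qpK i s z| ≤ CQc)
    (ℓS : SiteY i → UT Nf) (ℓB : BlkY i → UT Nf) {r : ℝ}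
    (hℓQ : ∀ s z, qpK i s z ≠ 0 → tdist1 Nf (ℓB s) (ℓS z) ≤ r) (hℓQs : ∀ z s, qpsK i z s ≠ 0 → tdist1 Nf (ℓS z) (ℓB s) ≤ r)
    {mS : ℕ} (hfibS : ∀ y : UT Nf, (univ.filter fun q : SiteY i × κ => ℓS q.1 = y).card ≤ mS)
    {ρ BG BX μ : ℝ} (hρ : 0 ≤ ρ)
    (hG : RawEntryLetters (fun u : E =>
      LinearMap.toMatrix ((Pi.basis fun _ : SiteY i => b).reindex (Equiv.sigmaEquivProd (SiteY i) κ))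
        ((Pi.basis fun _ : SiteY i => b).reindex (Equiv.sigmaEquivProd (SiteY i) κ)) (GsqY i parS D (F u)))
      (fun q : SiteY i × κ => ℓS q.1) Rc ρ BG)
    (hC : RawEntryLetters (fun u : E =>
      LinearMap.toMatrix ((Pi.basis fun _ : BlkY i => b).reindex (Equiv.sigmaEquivProd (BlkY i) κ))
        ((Pi.basis fun _ : BlkY i => b).reindex (Equiv.sigmaEquivProd (BlkY i) κ)) (ClocY i parS D P (F u)))
      (fun p : BlkY i × κ => ℓB p.1) Rc ρ BX)
    (hμ : 0 < μ) (h2μ : 2 * μ ≤ ρ) :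
    RawEntryLetters (fun u : E =>
        LinearMap.toMatrix ((Pi.basis fun _ : SiteY i => b).reindex (Equiv.sigmaEquivProd (SiteY i) κ))
          ((Pi.basis fun _ : SiteY i => b).reindex (Equiv.sigmaEquivProd (SiteY i) κ)) (RlocY i parS D P (F u)))
      (fun q : SiteY i × κ => ℓS q.1) Rc (ρ - 2 * μ)
      (1 + BG * (CQsr * (Fintype.card κ : ℝ) * (cb * (KQ * cl * KQ)) * (CQc * (Fintype.card κ : ℝ) * (cb * (KQ * cl * KQ))) * BX *
            Real.exp (2 * ρ * r) * BG * (mS * B6.c0 1 μ ^ ν)) * (mS * B6.c0 1 μ ^ ν)) := by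
  have hc0 : 0 ≤ cb * (KQ * cl * KQ) := mul_nonneg hcb0 (mul_nonneg (mul_nonneg hKQ hcl0) hKQ)
  have ha0 : 0 ≤ CQsr * (Fintype.card κ : ℝ) * (cb * (KQ * cl * KQ)) := mul_nonneg (mul_nonneg hCQsr0 (Nat.cast_nonneg _)) hc0
  have hb0 : 0 ≤ CQc * (Fintype.card κ : ℝ) * (cb * (KQ * cl * KQ)) := mul_nonneg (mul_nonneg hCQc0 (Nat.cast_nonneg _)) hc0
  -- the middle factor `N = Q′*·X⁻¹·Q′` on the site sector: (D′)'s sandwich, no rate loss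
  have hN := rawEntryLetters_sandwich_family (locp := fun q : SiteY i × κ => ℓS q.1) hC hρ
    (A := fun u => LinearMap.toMatrix ((Pi.basis fun _ : BlkY i => b).reindex (Equiv.sigmaEquivProd (BlkY i) κ))
        ((Pi.basis fun _ : SiteY i => b).reindex (Equiv.sigmaEquivProd (SiteY i) κ)) (QpsY i parS (F u)))
    (B' := fun u => LinearMap.toMatrix ((Pi.basis fun _ : SiteY i => b).reindex (Equiv.sigmaEquivProd (SiteY i) κ))
        ((Pi.basis fun _ : BlkY i => b).reindex (Equiv.sigmaEquivProd (BlkY i) κ)) (QpY i parS (F u)))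
    (r := r) ha0 hb0
    (fun q p => differentiableOn_toMatrix_QpsY_of_family i b parS F hcb hQh hQhi q p)
    (fun u _ q p hne => tdist_le_of_toMatrix_QpsY_ne_zero i b ℓS ℓB hℓQs parS (F u) q p hne)
    (fun u hu q => rowSum_blk_toMatrix_QpsY_le_of_family i b parS F hcb hcb0 hcl hcl0 hKQ hQsf hQsb hCQsr hu q)
    (fun p q => differentiableOn_toMatrix_QpY_of_family i b parS F hcb hQh hQhi p q)
    (fun u _ p q hne => tdist_le_of_toMatrix_QpY_ne_zero i b ℓS ℓB hℓQ parS (F u) p q hne)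
    (fun u hu q => colSum_blk_toMatrix_QpY_le_of_family i b parS F hcb hcb0 hcl hcl0 hKQ hQf hQb hCQc hu q)
  -- two square products with `G′` on the site sector, one rate loss each (34), then `1 − ·`
  have hNG := rawEntryLetters_mul_torus hN hG hμ (κ := ρ - μ) (by linarith) (by linarith) (by linarith) hfibS
  have hGNG := rawEntryLetters_mul_torus hG hNG hμ (κ := ρ - 2 * μ) (by linarith) (by linarith) (by linarith) hfibS
  have hRes := rawEntryLetters_sub (rawEntryLetters_one (E := E)
    (fun q : SiteY i × κ => ℓS q.1) Rc (ρ - 2 * μ)) hGNG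
  refine rawEntryLetters_congr hRes fun u _ => ?_
  rw [toMatrix_RlocY_eq]


end RStation

/-! ## §4. The PENCIL INSTANCES `F := prodCfg U₀ η` at def-Y's transporter letters v2 `parSY` (73) and v4 `parSymY` (78 §1) -/

section Pencil

variable [NormOneClass 𝔸]
variable {ν : ℕ} {Nf : Fin ν → ℕ} [∀ j, NeZero (Nf j)]
variable (U₀ : CfgY 𝔸 i) (η : ℝ)
variable (D : Finset (SiteY i)) (P : Module.End ℂ (BlkY i → 𝔸))

/-- ★★ **STATION L3 ON pv27's PENCIL AT def-Y's v2 LETTER `parSY`**, any cube `D`, any block cut `P`, ANY background `U₀` (the centre; its coercivity is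
L2's ∕ L5's business, not displayed here): §3 at `F := prodCfg U₀ η` with §1's four transporter facts discharged by 73 (`differentiableOn_qpT(_inv)_prodCfg`,
`norm_qpT(_inv)_prodCfg_le`) — `KQ = (K₀e^{|η|Rc})^{D_Q}` from the background's size `‖U₀(b)^{±1}‖ ≤ K₀`, `1 ≤ K₀` and the `Q′`-support numeral `D_Q`; w2 §4's
twin with `(G′, X⁻¹) ↦ (G′_□, C_□)`.  DISPLAYED: L1's `G′_□` pencil letters, L2's `C_□` pencil letters, `CQsr, CQc`, readings `ℓS ℓB` with `r`, `m_S`, `0 < μ`, `2μ ≤ ρ`.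
[cite: Balaban1985BackgroundPropagators, (3.19)–(3.21) pp.393–394, (3.25) p.394, (3.105) p.414, pp.408–409, (3.66)–(3.72) pp.403–405, Thm 3.10 (3.108) p.416] -/
theorem rawEntryLetters_toMatrix_RlocY_parSY_prodCfg {K₀ : ℝ} {Dq : ℕ}
    (hU : ∀ μ x, ‖(U₀ μ x : 𝔸)‖ ≤ K₀) (hUi : ∀ μ x, ‖(((U₀ μ x)⁻¹ : 𝔸ˣ) : 𝔸)‖ ≤ K₀) (hK1 : 1 ≤ K₀) (hR0 : 0 ≤ Rc)
    (hD : ∀ s z, qpK i s z ≠ 0 → Site.tdist ((boxEquiv i.hN).symm (blkCornerY i s)) ((boxEquiv i.hN).symm z) ≤ Dq)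
    (hDs : ∀ z s, qpsK i z s ≠ 0 → Site.tdist ((boxEquiv i.hN).symm (blkCornerY i s)) ((boxEquiv i.hN).symm z) ≤ Dq)
    {cb cl : ℝ} (hcb : ∀ (x : 𝔸) (k : κ), ‖b.repr x k‖ ≤ cb * ‖x‖) (hcb0 : 0 ≤ cb) (hcl : ∀ l, ‖b l‖ ≤ cl) (hcl0 : 0 ≤ cl)
    {CQsr CQc : ℝ} (hCQsr0 : 0 ≤ CQsr) (hCQsr : ∀ z, ∑ s, |qpsK i z s| ≤ CQsr) (hCQc0 : 0 ≤ CQc) (hCQc : ∀ z, ∑ s, |qpK i s z| ≤ CQc)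
    (ℓS : SiteY i → UT Nf) (ℓB : BlkY i → UT Nf) {r : ℝ}
    (hℓQ : ∀ s z, qpK i s z ≠ 0 → tdist1 Nf (ℓB s) (ℓS z) ≤ r) (hℓQs : ∀ z s, qpsK i z s ≠ 0 → tdist1 Nf (ℓS z) (ℓB s) ≤ r)
    {mS : ℕ} (hfibS : ∀ y : UT Nf, (univ.filter fun q : SiteY i × κ => ℓS q.1 = y).card ≤ mS)
    {ρ BG BX μ : ℝ} (hρ : 0 ≤ ρ)
    (hG : RawEntryLetters (fun a : Fin (d + 1) → Site (PV d ℓ i.m i.K hd hL) 0 → 𝔸 =>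
      LinearMap.toMatrix ((Pi.basis fun _ : SiteY i => b).reindex (Equiv.sigmaEquivProd (SiteY i) κ))
        ((Pi.basis fun _ : SiteY i => b).reindex (Equiv.sigmaEquivProd (SiteY i) κ)) (GsqY i (parSY i) D (prodCfg U₀ η a)))
      (fun q : SiteY i × κ => ℓS q.1) Rc ρ BG)
    (hC : RawEntryLetters (fun a : Fin (d + 1) → Site (PV d ℓ i.m i.K hd hL) 0 → 𝔸 =>
      LinearMap.toMatrix ((Pi.basis fun _ : BlkY i => b).reindex (Equiv.sigmaEquivProd (BlkY i) κ))
        ((Pi.basis fun _ : BlkY i => b).reindex (Equiv.sigmaEquivProd (BlkY i) κ)) (ClocY i (parSY i) D P (prodCfg U₀ η a)))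
      (fun p : BlkY i × κ => ℓB p.1) Rc ρ BX)
    (hμ : 0 < μ) (h2μ : 2 * μ ≤ ρ) :
    RawEntryLetters (fun a : Fin (d + 1) → Site (PV d ℓ i.m i.K hd hL) 0 → 𝔸 =>
        LinearMap.toMatrix ((Pi.basis fun _ : SiteY i => b).reindex (Equiv.sigmaEquivProd (SiteY i) κ))
          ((Pi.basis fun _ : SiteY i => b).reindex (Equiv.sigmaEquivProd (SiteY i) κ)) (RlocY i (parSY i) D P (prodCfg U₀ η a)))
      (fun q : SiteY i × κ => ℓS q.1) Rc (ρ - 2 * μ)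
      (1 + BG * (CQsr * (Fintype.card κ : ℝ) * (cb * ((K₀ * Real.exp (|η| * Rc)) ^ Dq * cl * (K₀ * Real.exp (|η| * Rc)) ^ Dq)) *
            (CQc * (Fintype.card κ : ℝ) * (cb * ((K₀ * Real.exp (|η| * Rc)) ^ Dq * cl * (K₀ * Real.exp (|η| * Rc)) ^ Dq))) * BX *
            Real.exp (2 * ρ * r) * BG * (mS * B6.c0 1 μ ^ ν)) * (mS * B6.c0 1 μ ^ ν)) := by
  have h1 : (1 : ℝ) ≤ K₀ * Real.exp (|η| * Rc) := one_le_mul_of_one_le_of_one_le hK1 (Real.one_le_exp (mul_nonneg (abs_nonneg _) hR0))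
  have hKQ : 0 ≤ (K₀ * Real.exp (|η| * Rc)) ^ Dq := pow_nonneg (zero_le_one.trans h1) Dq
  refine rawEntryLetters_toMatrix_RlocY_of_family i b (parSY i) (prodCfg U₀ η) D P hcb hcb0 hcl hcl0 hKQ
    (fun s z => differentiableOn_qpT_prodCfg i U₀ η s z) (fun s z => differentiableOn_qpT_inv_prodCfg i U₀ η s z)
    (fun a ha s z hM => (norm_qpT_prodCfg_le i U₀ η hU hUi hR0 ha s z).trans (pow_le_pow_right₀ h1 (hD s z hM)))
    (fun a ha s z hM => (norm_qpT_inv_prodCfg_le i U₀ η hU hUi hR0 ha s z).trans (pow_le_pow_right₀ h1 (hD s z hM)))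
    (fun a ha z s hM => (norm_qpT_inv_prodCfg_le i U₀ η hU hUi hR0 ha s z).trans (pow_le_pow_right₀ h1 (hDs z s hM)))
    (fun a ha z s hM => (norm_qpT_prodCfg_le i U₀ η hU hUi hR0 ha s z).trans (pow_le_pow_right₀ h1 (hDs z s hM)))
    hCQsr0 hCQsr hCQc0 hCQc ℓS ℓB hℓQ hℓQs hfibS hρ hG hC hμ h2μ

/-- ★★ **STATION L3 ON pv27's PENCIL AT def-Y's v4 LETTER `parSymY`** (N06's record letter), any cube `D`, block cut `P`, background `U₀`: §3 at
`F := prodCfg U₀ η` with the transporter facts discharged by the lane's module 78 §1 (`differentiableOn_parSymY(_inv)_prodCfg`, `norm_parSymY(_inv)_prodCfg_le`;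
`qpT i (parSymY i) U s z = parSymY U (corner s) z` by `rfl`) — w2's `B13OpsYPencilRProjSym` §1 twin with `(G′, X⁻¹) ↦ (G′_□, C_□)`.
[cite: Balaban1985BackgroundPropagators, (3.19)–(3.21) pp.393–394, (3.25) p.394, (3.105) p.414, pp.408–409, (3.66)–(3.72) pp.403–405, Thm 3.10 (3.108) p.416; Balaban1988RG2Cluster, (2.5)–(2.7) pp.12–13] -/
theorem rawEntryLetters_toMatrix_RlocY_parSymY_prodCfg {K₀ : ℝ} {Dq : ℕ}
    (hU : ∀ μ x, ‖(U₀ μ x : 𝔸)‖ ≤ K₀) (hUi : ∀ μ x, ‖(((U₀ μ x)⁻¹ : 𝔸ˣ) : 𝔸)‖ ≤ K₀) (hK1 : 1 ≤ K₀) (hR0 : 0 ≤ Rc)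
    (hD : ∀ s z, qpK i s z ≠ 0 → Site.tdist ((boxEquiv i.hN).symm (blkCornerY i s)) ((boxEquiv i.hN).symm z) ≤ Dq)
    (hDs : ∀ z s, qpsK i z s ≠ 0 → Site.tdist ((boxEquiv i.hN).symm (blkCornerY i s)) ((boxEquiv i.hN).symm z) ≤ Dq)
    {cb cl : ℝ} (hcb : ∀ (x : 𝔸) (k : κ), ‖b.repr x k‖ ≤ cb * ‖x‖) (hcb0 : 0 ≤ cb) (hcl : ∀ l, ‖b l‖ ≤ cl) (hcl0 : 0 ≤ cl)
    {CQsr CQc : ℝ} (hCQsr0 : 0 ≤ CQsr) (hCQsr : ∀ z, ∑ s, |qpsK i z s| ≤ CQsr) (hCQc0 : 0 ≤ CQc) (hCQc : ∀ z, ∑ s, |qpK i s z| ≤ CQc)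
    (ℓS : SiteY i → UT Nf) (ℓB : BlkY i → UT Nf) {r : ℝ}
    (hℓQ : ∀ s z, qpK i s z ≠ 0 → tdist1 Nf (ℓB s) (ℓS z) ≤ r) (hℓQs : ∀ z s, qpsK i z s ≠ 0 → tdist1 Nf (ℓS z) (ℓB s) ≤ r)
    {mS : ℕ} (hfibS : ∀ y : UT Nf, (univ.filter fun q : SiteY i × κ => ℓS q.1 = y).card ≤ mS)
    {ρ BG BX μ : ℝ} (hρ : 0 ≤ ρ)
    (hG : RawEntryLetters (fun a : Fin (d + 1) → Site (PV d ℓ i.m i.K hd hL) 0 → 𝔸 =>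
      LinearMap.toMatrix ((Pi.basis fun _ : SiteY i => b).reindex (Equiv.sigmaEquivProd (SiteY i) κ))
        ((Pi.basis fun _ : SiteY i => b).reindex (Equiv.sigmaEquivProd (SiteY i) κ)) (GsqY i (parSymY i) D (prodCfg U₀ η a)))
      (fun q : SiteY i × κ => ℓS q.1) Rc ρ BG)
    (hC : RawEntryLetters (fun a : Fin (d + 1) → Site (PV d ℓ i.m i.K hd hL) 0 → 𝔸 =>
      LinearMap.toMatrix ((Pi.basis fun _ : BlkY i => b).reindex (Equiv.sigmaEquivProd (BlkY i) κ))
        ((Pi.basis fun _ : BlkY i => b).reindex (Equiv.sigmaEquivProd (BlkY i) κ)) (ClocY i (parSymY i) D P (prodCfg U₀ η a)))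
      (fun p : BlkY i × κ => ℓB p.1) Rc ρ BX)
    (hμ : 0 < μ) (h2μ : 2 * μ ≤ ρ) :
    RawEntryLetters (fun a : Fin (d + 1) → Site (PV d ℓ i.m i.K hd hL) 0 → 𝔸 =>
        LinearMap.toMatrix ((Pi.basis fun _ : SiteY i => b).reindex (Equiv.sigmaEquivProd (SiteY i) κ))
          ((Pi.basis fun _ : SiteY i => b).reindex (Equiv.sigmaEquivProd (SiteY i) κ)) (RlocY i (parSymY i) D P (prodCfg U₀ η a)))
      (fun q : SiteY i × κ => ℓS q.1) Rc (ρ - 2 * μ)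
      (1 + BG * (CQsr * (Fintype.card κ : ℝ) * (cb * ((K₀ * Real.exp (|η| * Rc)) ^ Dq * cl * (K₀ * Real.exp (|η| * Rc)) ^ Dq)) *
            (CQc * (Fintype.card κ : ℝ) * (cb * ((K₀ * Real.exp (|η| * Rc)) ^ Dq * cl * (K₀ * Real.exp (|η| * Rc)) ^ Dq))) * BX *
            Real.exp (2 * ρ * r) * BG * (mS * B6.c0 1 μ ^ ν)) * (mS * B6.c0 1 μ ^ ν)) := by
  have h1 : (1 : ℝ) ≤ K₀ * Real.exp (|η| * Rc) := one_le_mul_of_one_le_of_one_le hK1 (Real.one_le_exp (mul_nonneg (abs_nonneg _) hR0))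
  have hKQ : 0 ≤ (K₀ * Real.exp (|η| * Rc)) ^ Dq := pow_nonneg (zero_le_one.trans h1) Dq
  exact rawEntryLetters_toMatrix_RlocY_of_family i b (parSymY i) (prodCfg U₀ η) D P hcb hcb0 hcl hcl0 hKQ
    (fun s z => differentiableOn_parSymY_prodCfg i U₀ η (blkCornerY i s) z) (fun s z => differentiableOn_parSymY_inv_prodCfg i U₀ η (blkCornerY i s) z)
    (fun a ha s z hM => (norm_parSymY_prodCfg_le i U₀ η hU hUi hR0 ha (blkCornerY i s) z).trans (pow_le_pow_right₀ h1 (hD s z hM)))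
    (fun a ha s z hM => (norm_parSymY_inv_prodCfg_le i U₀ η hU hUi hR0 ha (blkCornerY i s) z).trans (pow_le_pow_right₀ h1 (hD s z hM)))
    (fun a ha z s hM => (norm_parSymY_inv_prodCfg_le i U₀ η hU hUi hR0 ha (blkCornerY i s) z).trans (pow_le_pow_right₀ h1 (hDs z s hM)))
    (fun a ha z s hM => (norm_parSymY_prodCfg_le i U₀ η hU hUi hR0 ha (blkCornerY i s) z).trans (pow_le_pow_right₀ h1 (hDs z s hM)))
    hCQsr0 hCQsr hCQc0 hCQc ℓS ℓB hℓQ hℓQs hfibS hρ hG hC hμ h2μ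


end Pencil

end Literature.MathematicalPhysics.QuantumFieldTheory.Balaban1983to89.B13DirichletLocalRProjLetters

end
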